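import Literature.NumberTheory.ComplexMultiplication.CMOrderIdealClassMonoidOverorderCount
import Literature.NumberTheory.ComplexMultiplication.CMOrderQuadraticOverorders
import Literature.NumberTheory.ComplexMultiplication.CMOrderWeakEquivalence
import HarnessLib

/-!
# Marseglia's Theorem 4.6 counted, for ANY order: `#ICM_S(R) = #W̄k(S) · #Pic(S)` and
# `#ICM(R) = Σ_S #W̄k(S) · #Pic(S)` — the stratum of an over-order is a disjoint union of `Pic(S)`-torsors indexed
# by the weak equivalence classes

Family `hodge`, lane `lit-hodgefound` (Track 2 foundations library; seat p15, row g25-#4 — the general-degree form of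
g24-#2 `CMOrderIdealClassMonoidOverorderCount` (`#ICM(𝔯) = Σ_S #ICM_S(𝔯)` for any order; `#ICM_S = #Pic(S)` for
QUADRATIC orders, where `W̄k(S)` is a singleton) on top of g24-#5 `CMOrderWeakEquivalence` (Prop. 4.1 (b)⟺(c),
Cor. 4.5, Thm. 4.6's freeness for any order)), topic `Literature/NumberTheory/ComplexMultiplication`.  THEOREMS ONLY:
no definition, no instance, no named fact (D-0026, net Literature debt `0`).  Everything holds for EVERY order
`𝔯 = endOrder ρ` of the series (no trace duals are used).

Carriers, BY NAME: Mathlib's `FractionalIdeal 𝔯⁰ K` with `/`, `*`, `spanSingleton`; the STRATUM of an over-order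
`S : Subring K` is, as in g24-#2, the subtype `{M // M ≠ 0 ∧ ((M:M) : Set K) = S}`; on it the class relation
`M ∼ N :⟺ M = xN` (`x ∈ K^×`; `ICM_S(𝔯)` = its `Quot`) and the WEAK relation `1 ∈ (M:N)(N:M)` (PROP. 4.1 (b);
`W̄k(S)` = its `Quot`); `Pic(S)` is the `Quot` by `∼` of the sub-subtype of the `L` invertible in their multiplicator
ring, `L·((L:L):L) = (L:L)`.  No quotient TYPE is named: the three `Quot`s are written out in every statement.

## Source, VERBATIM

S. Marseglia, *Computing the ideal class monoid of an order*, J. Lond. Math. Soc. (2) 101 (2020) [Marseglia2019],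
held `paper:arxiv-1805.09671`, §4 pp. 8–9 (chunks p0008–p0009):

> **Definition 4.2.** If two fractional `R`-ideals `I` and `J` satisfy the equivalent conditions of Proposition 4.1
> we say that they are weakly equivalent. Denote by `Wk(R)` the set of weak equivalence classes […]. Given any
> over-order `S` of `R` let `W̄k(S)` be the subset of `Wk(R)` consisting of the weak equivalence classes `[I]` such
> that `(I:I) = S`. […] Let `S` be an over-order of `R` and define `ICM_S = {[I] ∈ ICM(R) s.t. (I:I) = S}`, so that
> we get `ICM(R) = ⊔ ICM_S`.
> **Theorem 4.6.** Let `R` be an order in `K`. For every over-order `S` of `R`, the action of `Pic(S)` on `ICM_S`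
> induced by ideal multiplication is free and `W̄k(S) = ICM_S / Pic(S)`. More concretely, if
> `W̄k(S) = {[I₁],…,[I_r]}` and `Pic(S) = {[J₁],…,[J_s]}`, with the `Iᵢ`'s pairwise not weakly equivalent and the
> `Jⱼ`'s pairwise not isomorphic then `ICM_S = {[IᵢJⱼ] : 1 ≤ i ≤ r, 1 ≤ j ≤ s}` and the fractional ideals `IᵢJⱼ`
> are pairwise not isomorphic.
> *Proof.* Let `I` be a fractional `R`-ideal with multiplicator ring `S`. Then `[I]_wk = [Iᵢ]_wk` for some `i`, that
> is, there exists a fractional ideal `J` invertible in `S` such that `I = IᵢJ`. […] It remains to prove that if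
> `[IᵢJⱼ] = [I_kJ_h]`, that is `IᵢJⱼ = xI_kJ_h` for some `x ∈ K^×`, then `i = k` and `j = h`. Multiplying by
> `(S:Jⱼ)` on both sides we get by Proposition 4.1 (c) that `Iᵢ` is weakly equivalent to `I_k`, that is, `i = k`.
> To conclude, it is enough to prove that if `I = IJ` with `I` and `J` both having multiplicator ring `S` and `J`
> invertible in `S`, then `J = S`.
> (after Remark 4.7) Using Theorem 4.6 we can compute the ideal class monoid of an order `R` if we know all its
> over-orders, their Picard groups and the weak equivalence class monoid.

## What is formalised

* §1 `div_mul_div_le_div` (`(I:J)(J:L) ⊆ (I:L)`), `one_mem_div_mul_div_trans` (weak equivalence is transitive),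
  `one_mem_div_mul_div_of_eq_spanSingleton_mul` (isomorphic ⟹ weakly equivalent), **`equivalence_one_mem_div_mul_div`**
  (weak equivalence is an equivalence relation on any family of nonzero fractional ideals — `Wk(R)`).
* §2 the action of `Pic(S)` on `ICM_S`: **`mul_div_mul_eq_of_mul_div_eq`** (`(LI:LI) = S`), `one_mem_div_mul_div_mul_left`
  (`LI ~ I`), `mul_div_self_div_eq_div_self_of_mul_eq` (an `S`-invertible `S`-ideal lies in `Pic(S)` on the base
  carrier), **FREENESS `eq_spanSingleton_mul_of_mul_eq_spanSingleton_mul_mul`** (`LI = x·L₁I ⟹ L = x·L₁`),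
  **TRANSITIVITY `div_invertible_and_div_mul_eq_of_one_mem`** (`I ~ I₀ ⟹ I = (I:I₀)I₀` with `(I:I₀)` invertible in `S`).
* §3 **THEOREM 4.6 counted `natCard_quot_stratum_eq_natCard_quot_weak_mul_natCard_quot_pic`** (`#ICM_S = #W̄k(S)·#Pic(S)`:
  the fibres of `ICM_S → W̄k(S)` are `Pic(S)`-torsors), **`natCard_quot_fractionalIdeal_eq_sum_natCard_quot_weak_mul_natCard_quot_pic`**
  (`#ICM(𝔯) = Σ_S #W̄k(S)·#Pic(S)`), and `natCard_quot_stratum_eq_natCard_quot_pic_of_forall_one_mem`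
  (`W̄k(S) = {[S]}` ⟹ `#ICM_S = #Pic(S)` — the Gorenstein / quadratic case of g24-#2).

NOT formalised: the monoid structure of `Wk(R)`; `Pic(S)` as Mathlib's `ClassGroup` of the over-order ring (g24-#2
does this junction for quadratic orders); Remark 4.7's example `x² − 8x − 8`; the algorithms of §5–§6.

## References
* [Marseglia2019] S. Marseglia, *Computing the ideal class monoid of an order*, J. Lond. Math. Soc. (2) 101 (2020)
  984–1007, §4 Def. 4.2, Prop. 4.1, Cor. 4.5, Thm. 4.6, pp. 8–9. [cite: Marseglia2019, §4 Thm. 4.6, p. 9]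
* [DadeTausskyZassenhaus1962] E. C. Dade, O. Taussky, H. Zassenhaus, *On the theory of orders, in particular on the
  semigroup of ideal classes and genera of an order in an algebraic number field*, Math. Ann. 148 (1962) 31–64
  («proved in [DTZ] in the particular case of an integral domain»). [cite: DadeTausskyZassenhaus1962, §1]
-/

noncomputable section

open scoped nonZeroDivisors NumberField Pointwise
open NumberField Module FractionalIdeal

namespace Literature.NumberTheory.ComplexMultiplication

namespace EndOrder

section AnyOrder

variable {K : Type} [Field K] [NumberField K]
variable {ι : Type} [Fintype ι] [DecidableEq ι] {ρ : K →ₐ[ℚ] Matrix ι ι ℚ}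
variable [IsFractionRing (endOrder ρ) K]

/-! ## §1 Weak equivalence is an equivalence relation containing isomorphism -/

/-- `(I:J)(J:L) ⊆ (I:L)` («by definition of quotient ideal»). [cite: Marseglia2019, §4 Prop. 4.1 (proof of (b)⇒(c)), p. 8] -/
theorem div_mul_div_le_div {I J L : FractionalIdeal (endOrder ρ)⁰ K} (hJ : J ≠ 0) (hL : L ≠ 0) :
    I / J * (J / L) ≤ I / L := by
  refine mul_le.2 fun x hx y hy => (mem_div_iff_of_ne_zero hL).2 fun l hl => ?_
  rw [mul_assoc]
  exact (mem_div_iff_of_ne_zero hJ).1 hx _ ((mem_div_iff_of_ne_zero hL).1 hy l hl)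

/-- **Weak equivalence is transitive**: `1 ∈ (I:J)(J:I)` and `1 ∈ (J:L)(L:J)` give `1 ∈ (I:L)(L:I)`
(`(I:J)(J:L) ⊆ (I:L)`, `(L:J)(J:I) ⊆ (L:I)`). [cite: Marseglia2019, §4 Def. 4.2 («we say that they are weakly
equivalent»: an equivalence relation, `Wk(R)` the set of classes), p. 8] -/
theorem one_mem_div_mul_div_trans {I J L : FractionalIdeal (endOrder ρ)⁰ K} (hI : I ≠ 0) (hJ : J ≠ 0) (hL : L ≠ 0)
    (h₁ : (1 : K) ∈ I / J * (J / I)) (h₂ : (1 : K) ∈ J / L * (L / J)) : (1 : K) ∈ I / L * (L / I) := by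
  have h := mul_mem_mul h₁ h₂
  rw [mul_one, mul_mul_mul_comm, mul_comm (J / I) (L / J)] at h
  exact mul_le_mul' (div_mul_div_le_div hJ hL) (div_mul_div_le_div hJ hI) h

/-- **Isomorphic ideals are weakly equivalent**: `M = xN` (`x ∈ K^×`) gives `1 ∈ (M:N)(N:M)` («being weakly
equivalent is a necessary condition for being isomorphic»). [cite: Marseglia2019, §4 (before Cor. 4.5), p. 8] -/
theorem one_mem_div_mul_div_of_eq_spanSingleton_mul {M N : FractionalIdeal (endOrder ρ)⁰ K} {x : K} (hx : x ≠ 0)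
    (hN : N ≠ 0) (h : M = spanSingleton (endOrder ρ)⁰ x * N) : (1 : K) ∈ M / N * (N / M) := by
  have hM : M ≠ 0 := fun h0 => hN (by
    rw [h0] at h
    have := congrArg (spanSingleton (endOrder ρ)⁰ x⁻¹ * ·) h
    simpa only [mul_zero, ← mul_assoc, spanSingleton_mul_spanSingleton, inv_mul_cancel₀ hx, spanSingleton_one,
      one_mul] using this.symm)
  refine one_mem_div_mul_div_of_mul_eq hM hN h.symm (L' := spanSingleton (endOrder ρ)⁰ x⁻¹) ?_ ?_
  · rw [h, ← mul_assoc, spanSingleton_mul_spanSingleton, inv_mul_cancel₀ hx, spanSingleton_one, one_mul]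
  · rw [spanSingleton_mul_spanSingleton, mul_inv_cancel₀ hx, spanSingleton_one]
    exact one_mem_one _

/-- **Weak equivalence `1 ∈ (M:N)(N:M)` is an equivalence relation** on any family of nonzero fractional ideals
(the set `Wk(R)` of weak equivalence classes, DEF. 4.2). [cite: Marseglia2019, §4 Def. 4.2, p. 8] -/
theorem equivalence_one_mem_div_mul_div (p : FractionalIdeal (endOrder ρ)⁰ K → Prop)
    (hp : ∀ M, p M → M ≠ 0) :
    Equivalence fun M N : {M : FractionalIdeal (endOrder ρ)⁰ K // p M} =>
      (1 : K) ∈ (M : FractionalIdeal (endOrder ρ)⁰ K) / N * (N / M) := by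
  refine ⟨fun M => one_mem_div_self_mul_div_self (hp M.1 M.2), fun {M N} h => by rwa [mul_comm],
    fun {M N L} h₁ h₂ => one_mem_div_mul_div_trans (hp M.1 M.2) (hp N.1 N.2) (hp L.1 L.2) h₁ h₂⟩

variable [Nonempty ι]

/-! ## §2 `Pic(S)` acts on `ICM_S`: products `LI`, `L` invertible in `S`, `(I:I) = S` -/

omit [Nonempty ι] in
/-- **`(LI : LI) = S` for `L` invertible in the over-order `S = M` and `(I:I) = M`**: the action of `Pic(S)` on
`ICM_S(R) = {[I] : (I:I) = S}` by ideal multiplication is well defined (`x·LI ⊆ LI ⟹ x·(M:L)LI ⊆ (M:L)LI`, i.e.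
`xI ⊆ I`). [cite: Marseglia2019, §4 Thm. 4.6 («the action of `Pic(S)` on `ICM_S` induced by ideal multiplication»), p. 9] -/
theorem mul_div_mul_eq_of_mul_div_eq {M L I : FractionalIdeal (endOrder ρ)⁰ K} (hM0 : M ≠ 0)
    (hML : M * L = L) (hLinv : L * (M / L) = M) (hI : I ≠ 0) (hII : I / I = M) : L * I / (L * I) = M := by
  have hL0 : L ≠ 0 := fun h => hM0 (by rw [← hLinv, h, zero_mul])
  have hLI0 : L * I ≠ 0 := fractionalIdeal_mul_ne_zero hL0 hI
  have hMI : M * I = I := by rw [← hII, div_self_mul_self_eq hI]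
  refine le_antisymm (fun x hx => ?_) ((le_div_iff_mul_le hLI0).2 (by rw [← mul_assoc, hML]))
  have hxLI : spanSingleton (endOrder ρ)⁰ x * (L * I) ≤ L * I := by
    rw [← le_div_iff_mul_le hLI0, spanSingleton_le_iff_mem]
    exact hx
  have hxI : spanSingleton (endOrder ρ)⁰ x * I ≤ I :=
    calc spanSingleton (endOrder ρ)⁰ x * I = M / L * (spanSingleton (endOrder ρ)⁰ x * (L * I)) := by
          rw [mul_left_comm, ← mul_assoc (M / L), mul_comm (M / L) L, hLinv, hMI]
      _ ≤ M / L * (L * I) := mul_le_mul' le_rfl hxLI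
      _ = I := by rw [← mul_assoc, mul_comm (M / L) L, hLinv, hMI]
  rw [← hII, ← spanSingleton_le_iff_mem, le_div_iff_mul_le hI]
  exact hxI

/-- **`LI` is weakly equivalent to `I`** (`L` invertible in `M`, `MI = I`): `1 ∈ (LI:I)(I:LI)` — PROP. 4.1 (c)⇒(b).
[cite: Marseglia2019, §4 Prop. 4.1 ((c)⇒(b)), p. 8] -/
theorem one_mem_div_mul_div_mul_left {M L I : FractionalIdeal (endOrder ρ)⁰ K} (hMM : M * M = M) (hM0 : M ≠ 0)
    (hLinv : L * (M / L) = M) (hI : I ≠ 0) (hMI : M * I = I) : (1 : K) ∈ L * I / I * (I / (L * I)) := by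
  haveI := CMTypeLattice.isNoetherianRing_endOrder ρ
  have hL0 : L ≠ 0 := fun h => hM0 (by rw [← hLinv, h, zero_mul])
  refine one_mem_div_mul_div_of_mul_eq (fractionalIdeal_mul_ne_zero hL0 hI) hI rfl (L' := M / L) ?_ ?_
  · rw [← mul_assoc, mul_comm (M / L) L, hLinv, hMI]
  · rw [hLinv]
    exact one_mem_of_mul_self_eq hM0 hMM

/-- **An ideal invertible in an over-order is invertible in its multiplicator ring with the canonical inverse**:
`ML = L`, `LL′ = M` (`M = MM ≠ 0`) give `(L:L) = M` (LEMMA 2.5) and `L·((L:L):L) = (L:L)`.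
[cite: Marseglia2019, §2 Lemma 2.5 and §3 («`[I]` is in `Pic(S)`»), pp. 5–6] -/
theorem mul_div_self_div_eq_div_self_of_mul_eq {M L L' : FractionalIdeal (endOrder ρ)⁰ K} (hMM : M * M = M)
    (hM0 : M ≠ 0) (hML : M * L = L) (hLL' : L * L' = M) : L / L = M ∧ L * (L / L / L) = L / L := by
  have hL0 : L ≠ 0 := fun h => hM0 (by rw [← hLL', h, zero_mul])
  have hS : L / L = M := div_self_eq_of_mul_eq_overorder hMM hM0 hML hLL'
  refine ⟨hS, ?_⟩
  rw [hS]
  refine le_antisymm (mul_div_le hL0) ?_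
  calc M = L * L' := hLL'.symm
    _ ≤ L * (M / L) := mul_le_mul' le_rfl ((le_div_iff_mul_le hL0).2 (by rw [mul_comm, hLL']))

omit [Nonempty ι] in
/-- **THEOREM 4.6, freeness («the fractional ideals `IᵢJⱼ` are pairwise not isomorphic», same `i`): if
`LI = x·L₁I` with `L`, `L₁` invertible in `M = (I:I)`, then `L = x·L₁`** — multiply by `(M:L₁)` and use the
tree's `eq_spanSingleton_mul_div_self_of_mul_eq` («if `I = IJ` … then `J = S`»).
[cite: Marseglia2019, §4 Thm. 4.6 (proof: «Multiplying by `(S:Jⱼ)` on both sides …»), p. 9] -/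
theorem eq_spanSingleton_mul_of_mul_eq_spanSingleton_mul_mul {M L L₁ I : FractionalIdeal (endOrder ρ)⁰ K} {x : K}
    (hx : x ≠ 0) (hMM : M * M = M) (hML : M * L = L) (hLinv : L * (M / L) = M) (hML₁ : M * L₁ = L₁)
    (hL₁inv : L₁ * (M / L₁) = M) (hI : I ≠ 0) (hII : I / I = M)
    (h : L * I = spanSingleton (endOrder ρ)⁰ x * (L₁ * I)) : L = spanSingleton (endOrder ρ)⁰ x * L₁ := by
  have hMI : M * I = I := by rw [← hII, div_self_mul_self_eq hI]
  -- `J = L·(M:L₁)` satisfies `IJ = xI`, is an `M`-ideal and is invertible in `M`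
  have hSJ : I / I * (L * (M / L₁)) = L * (M / L₁) := by rw [hII, ← mul_assoc, hML]
  have hJJ' : L * (M / L₁) * (M / L * L₁) = I / I := by
    rw [hII, mul_mul_mul_comm, hLinv, mul_comm (M / L₁) L₁, hL₁inv, hMM]
  have hIJ : I * (L * (M / L₁)) = spanSingleton (endOrder ρ)⁰ x * I := by
    calc I * (L * (M / L₁)) = L * I * (M / L₁) := by rw [← mul_assoc, mul_comm I L]
      _ = spanSingleton (endOrder ρ)⁰ x * (L₁ * (M / L₁) * I) := by
          rw [h, mul_assoc, mul_assoc, mul_assoc, mul_comm I (M / L₁)]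
      _ = spanSingleton (endOrder ρ)⁰ x * I := by rw [hL₁inv, hMI]
  have hJ := eq_spanSingleton_mul_div_self_of_mul_eq hx hI hSJ hJJ' hIJ
  -- `L·(M:L₁) = xM`; multiply by `L₁`
  rw [hII] at hJ
  calc L = L * (M / L₁ * L₁) := by rw [mul_comm (M / L₁) L₁, hL₁inv, mul_comm, hML]
    _ = spanSingleton (endOrder ρ)⁰ x * M * L₁ := by rw [← mul_assoc, hJ]
    _ = spanSingleton (endOrder ρ)⁰ x * L₁ := by rw [mul_assoc, hML₁]

/-- **THEOREM 4.6, transitivity on a weak class («there exists a fractional ideal `J` invertible in `S` such that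
`I = IᵢJ`»)**: if `I` and `I₀` are weakly equivalent with multiplicator ring `M`, then `L = (I:I₀)` is an `M`-ideal
invertible in `M` (`L·(I₀:I) = M`, COR. 4.5) with `I = L·I₀`. [cite: Marseglia2019, §4 Thm. 4.6 (proof) and Cor. 4.5, pp. 8–9] -/
theorem div_invertible_and_div_mul_eq_of_one_mem {M I I₀ : FractionalIdeal (endOrder ρ)⁰ K} (hMM : M * M = M)
    (hM0 : M ≠ 0) (hI : I ≠ 0) (hI₀ : I₀ ≠ 0) (hII : I / I = M) (h1 : (1 : K) ∈ I / I₀ * (I₀ / I)) :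
    M * (I / I₀) = I / I₀ ∧ I / I₀ * (I₀ / I) = M ∧ I / I₀ * I₀ = I := by
  haveI := CMTypeLattice.isNoetherianRing_endOrder ρ
  refine ⟨?_, by rw [← hII]; exact div_mul_div_eq_div_self_of_one_mem hI hI₀ h1, div_mul_eq_of_one_mem hI hI₀ h1⟩
  refine le_antisymm (by rw [← hII]; exact div_self_mul_div_le hI hI₀) fun y hy => ?_
  rw [← one_mul y]
  exact mul_mem_mul (one_mem_of_mul_self_eq hM0 hMM) hy

/-! ## §3 THEOREM 4.6 counted: `#ICM_S(𝔯) = #W̄k(S) · #Pic(S)`, hence `#ICM(𝔯) = Σ_S #W̄k(S) · #Pic(S)` -/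

/-- **THEOREM 4.6 (Marseglia), counted: `#ICM_S(R) = #W̄k(S) · #Pic(S)` for every over-order `S` of ANY order
`R = 𝔯`** — «the action of `Pic(S)` on `ICM_S` induced by ideal multiplication is free and `W̄k(S) = ICM_S/Pic(S)`.
More concretely, if `W̄k(S) = {[I₁],…,[I_r]}` and `Pic(S) = {[J₁],…,[J_s]}` […] then `ICM_S = {[IᵢJⱼ]}` and the
fractional ideals `IᵢJⱼ` are pairwise not isomorphic».  Carriers: the stratum `ICM_S(𝔯)` = nonzero fractional
ideals with `((M:M) : Set K) = S` modulo `M ∼ xN` (as in `CMOrderIdealClassMonoidOverorderCount`), `W̄k(S)` = the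
same set modulo weak equivalence `1 ∈ (M:N)(N:M)`, `Pic(S)` = those `L` of the stratum that are invertible in
their multiplicator ring (`L·((L:L):L) = (L:L)`) modulo `∼`.  Proof: the fibre of `ICM_S → W̄k(S)` over `[I₀]` is
`{[L·I₀] : [L] ∈ Pic(S)}` (COR. 4.5: `I = (I:I₀)I₀`), and `[L·I₀] = [L₁·I₀] ⟹ [L] = [L₁]` (freeness).
[cite: Marseglia2019, §4 Thm. 4.6, p. 9] [cite: DadeTausskyZassenhaus1962, §1] -/
theorem natCard_quot_stratum_eq_natCard_quot_weak_mul_natCard_quot_pic (S : Subring K) :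
    Nat.card (Quot fun M N : {M : FractionalIdeal (endOrder ρ)⁰ K //
        M ≠ 0 ∧ ((M / M : FractionalIdeal (endOrder ρ)⁰ K) : Set K) = S} =>
      ∃ x : K, x ≠ 0 ∧ (M : FractionalIdeal (endOrder ρ)⁰ K) = spanSingleton (endOrder ρ)⁰ x * N) =
    Nat.card (Quot fun M N : {M : FractionalIdeal (endOrder ρ)⁰ K //
        M ≠ 0 ∧ ((M / M : FractionalIdeal (endOrder ρ)⁰ K) : Set K) = S} =>
      (1 : K) ∈ (M : FractionalIdeal (endOrder ρ)⁰ K) / N * (N / M)) *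
    Nat.card (Quot fun L N : {L : FractionalIdeal (endOrder ρ)⁰ K //
        (L ≠ 0 ∧ ((L / L : FractionalIdeal (endOrder ρ)⁰ K) : Set K) = S) ∧ L * (L / L / L) = L / L} =>
      ∃ x : K, x ≠ 0 ∧ (L : FractionalIdeal (endOrder ρ)⁰ K) = spanSingleton (endOrder ρ)⁰ x * N) := by
  classical
  -- the common multiplicator ring of the stratum
  have hmr : ∀ I J : {M : FractionalIdeal (endOrder ρ)⁰ K // M ≠ 0 ∧ ((M / M : FractionalIdeal (endOrder ρ)⁰ K) : Set K) = S},
      (I.1 / I.1 : FractionalIdeal (endOrder ρ)⁰ K) = J.1 / J.1 := fun I J =>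
    SetLike.coe_injective (I.2.2.trans J.2.2.symm)
  have hid : ∀ I : {M : FractionalIdeal (endOrder ρ)⁰ K // M ≠ 0 ∧ ((M / M : FractionalIdeal (endOrder ρ)⁰ K) : Set K) = S},
      I.1 / I.1 * (I.1 / I.1) = I.1 / I.1 := fun I => div_self_mul_div_self I.2.1
  have hne : ∀ I : {M : FractionalIdeal (endOrder ρ)⁰ K // M ≠ 0 ∧ ((M / M : FractionalIdeal (endOrder ρ)⁰ K) : Set K) = S},
      I.1 / I.1 ≠ 0 := fun I => div_self_ne_zero I.2.1
  -- the two equivalence relations on the stratum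
  have hEr := equivalence_exists_eq_spanSingleton_mul (ρ := ρ) (K := K)
    (fun M => M ≠ 0 ∧ ((M / M : FractionalIdeal (endOrder ρ)⁰ K) : Set K) = S)
  have hEw := equivalence_one_mem_div_mul_div (ρ := ρ) (K := K)
    (fun M => M ≠ 0 ∧ ((M / M : FractionalIdeal (endOrder ρ)⁰ K) : Set K) = S) (fun M h => h.1)
  -- the projection `π : ICM_S → W̄k(S)` (isomorphic ideals are weakly equivalent)
  let π : (Quot fun M N : {M : FractionalIdeal (endOrder ρ)⁰ K //
        M ≠ 0 ∧ ((M / M : FractionalIdeal (endOrder ρ)⁰ K) : Set K) = S} =>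
      ∃ x : K, x ≠ 0 ∧ (M : FractionalIdeal (endOrder ρ)⁰ K) = spanSingleton (endOrder ρ)⁰ x * N) →
      Quot fun M N : {M : FractionalIdeal (endOrder ρ)⁰ K //
        M ≠ 0 ∧ ((M / M : FractionalIdeal (endOrder ρ)⁰ K) : Set K) = S} =>
      (1 : K) ∈ (M : FractionalIdeal (endOrder ρ)⁰ K) / N * (N / M) :=
    Quot.lift (fun M => Quot.mk _ M) fun M N h => Quot.sound (by
      obtain ⟨x, hx, h⟩ := h
      exact one_mem_div_mul_div_of_eq_spanSingleton_mul hx N.2.1 h)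
  -- finiteness: `ICM_S ↪ ICM(𝔯)` (finite), `ICM_S ↠ W̄k(S)`
  haveI := finite_quot_fractionalIdeal (ρ := ρ) (K := K)
  haveI hfinT : Finite (Quot fun M N : {M : FractionalIdeal (endOrder ρ)⁰ K //
        M ≠ 0 ∧ ((M / M : FractionalIdeal (endOrder ρ)⁰ K) : Set K) = S} =>
      ∃ x : K, x ≠ 0 ∧ (M : FractionalIdeal (endOrder ρ)⁰ K) = spanSingleton (endOrder ρ)⁰ x * N) := by
    refine Finite.of_injective (Quot.lift (fun M => Quot.mk (fun M N : {M : FractionalIdeal (endOrder ρ)⁰ K // M ≠ 0} =>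
        ∃ x : K, x ≠ 0 ∧ (M : FractionalIdeal (endOrder ρ)⁰ K) = spanSingleton (endOrder ρ)⁰ x * N) ⟨M.1, M.2.1⟩)
      fun M N h => Quot.sound h) ?_
    intro q₁ q₂ h
    induction q₁ using Quot.ind with | mk M => ?_
    induction q₂ using Quot.ind with | mk N => ?_
    have h' : Quot.mk (fun M N : {M : FractionalIdeal (endOrder ρ)⁰ K // M ≠ 0} =>
        ∃ x : K, x ≠ 0 ∧ (M : FractionalIdeal (endOrder ρ)⁰ K) = spanSingleton (endOrder ρ)⁰ x * N) ⟨M.1, M.2.1⟩ =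
        Quot.mk _ ⟨N.1, N.2.1⟩ := h
    exact Quot.sound ((equivalence_exists_eq_spanSingleton_mul fun M : FractionalIdeal (endOrder ρ)⁰ K => M ≠ 0).eqvGen_iff.1
      (Quot.eqvGen_exact h'))
  haveI hfinW : Finite (Quot fun M N : {M : FractionalIdeal (endOrder ρ)⁰ K //
        M ≠ 0 ∧ ((M / M : FractionalIdeal (endOrder ρ)⁰ K) : Set K) = S} =>
      (1 : K) ∈ (M : FractionalIdeal (endOrder ρ)⁰ K) / N * (N / M)) :=
    Finite.of_surjective π fun q => Quot.inductionOn q fun M => ⟨Quot.mk _ M, rfl⟩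
  letI := Fintype.ofFinite (Quot fun M N : {M : FractionalIdeal (endOrder ρ)⁰ K //
        M ≠ 0 ∧ ((M / M : FractionalIdeal (endOrder ρ)⁰ K) : Set K) = S} =>
      (1 : K) ∈ (M : FractionalIdeal (endOrder ρ)⁰ K) / N * (N / M))
  -- the fibre over `[I₀]` is `Pic(S)·[I₀] ≃ Pic(S)`
  have hfib : ∀ q₀, Nat.card {q // π q = q₀} =
      Nat.card (Quot fun L N : {L : FractionalIdeal (endOrder ρ)⁰ K //
          (L ≠ 0 ∧ ((L / L : FractionalIdeal (endOrder ρ)⁰ K) : Set K) = S) ∧ L * (L / L / L) = L / L} =>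
        ∃ x : K, x ≠ 0 ∧ (L : FractionalIdeal (endOrder ρ)⁰ K) = spanSingleton (endOrder ρ)⁰ x * N) := by
    intro q₀
    induction q₀ using Quot.ind with | mk I₀ => ?_
    -- `Pic(S)` on the base carrier: `(L:L) = (I₀:I₀) =: M`, `ML = L`, `L(M:L) = M`
    have hP : ∀ L : {L : FractionalIdeal (endOrder ρ)⁰ K //
        (L ≠ 0 ∧ ((L / L : FractionalIdeal (endOrder ρ)⁰ K) : Set K) = S) ∧ L * (L / L / L) = L / L},
        I₀.1 / I₀.1 * L.1 = L.1 ∧ L.1 * (I₀.1 / I₀.1 / L.1) = I₀.1 / I₀.1 := fun L => by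
      have hLL : L.1 / L.1 = I₀.1 / I₀.1 := SetLike.coe_injective (L.2.1.2.trans I₀.2.2.symm)
      refine ⟨?_, ?_⟩
      · rw [← hLL]
        exact div_self_mul_self_eq L.2.1.1
      · have h := L.2.2
        rwa [hLL] at h
    have hMI₀ : I₀.1 / I₀.1 * I₀.1 = I₀.1 := div_self_mul_self_eq I₀.2.1
    have hmem : ∀ L : {L : FractionalIdeal (endOrder ρ)⁰ K //
        (L ≠ 0 ∧ ((L / L : FractionalIdeal (endOrder ρ)⁰ K) : Set K) = S) ∧ L * (L / L / L) = L / L},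
        L.1 * I₀.1 ≠ 0 ∧ ((L.1 * I₀.1 / (L.1 * I₀.1) : FractionalIdeal (endOrder ρ)⁰ K) : Set K) = S := fun L =>
      ⟨fractionalIdeal_mul_ne_zero L.2.1.1 I₀.2.1,
        by rw [mul_div_mul_eq_of_mul_div_eq (hne I₀) (hP L).1 (hP L).2 I₀.2.1 rfl]; exact I₀.2.2⟩
    have hfiber : ∀ L : {L : FractionalIdeal (endOrder ρ)⁰ K //
        (L ≠ 0 ∧ ((L / L : FractionalIdeal (endOrder ρ)⁰ K) : Set K) = S) ∧ L * (L / L / L) = L / L},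
        π (Quot.mk _ ⟨L.1 * I₀.1, hmem L⟩) = Quot.mk _ I₀ := fun L =>
      Quot.sound (one_mem_div_mul_div_mul_left (hid I₀) (hne I₀) (hP L).2 I₀.2.1 hMI₀)
    let φ : (Quot fun L N : {L : FractionalIdeal (endOrder ρ)⁰ K //
          (L ≠ 0 ∧ ((L / L : FractionalIdeal (endOrder ρ)⁰ K) : Set K) = S) ∧ L * (L / L / L) = L / L} =>
        ∃ x : K, x ≠ 0 ∧ (L : FractionalIdeal (endOrder ρ)⁰ K) = spanSingleton (endOrder ρ)⁰ x * N) →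
        {q // π q = Quot.mk _ I₀} :=
      Quot.lift (fun L => ⟨Quot.mk _ ⟨L.1 * I₀.1, hmem L⟩, hfiber L⟩) fun L L₁ h => Subtype.ext (Quot.sound (by
        obtain ⟨x, hx, h⟩ := h
        exact ⟨x, hx, by simp only; rw [h, mul_assoc]⟩))
    refine (Nat.card_eq_of_bijective φ ⟨?_, ?_⟩).symm
    · -- freeness
      intro c₁ c₂ h
      induction c₁ using Quot.ind with | mk L => ?_
      induction c₂ using Quot.ind with | mk L₁ => ?_
      obtain ⟨x, hx, hxe⟩ := hEr.eqvGen_iff.1 (Quot.eqvGen_exact (congrArg Subtype.val h))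
      exact Quot.sound ⟨x, hx, eq_spanSingleton_mul_of_mul_eq_spanSingleton_mul_mul hx (hid I₀) (hP L).1 (hP L).2
        (hP L₁).1 (hP L₁).2 I₀.2.1 rfl hxe⟩
    · -- transitivity on the weak class: `I = (I:I₀)·I₀`
      rintro ⟨q, hq⟩
      induction q using Quot.ind with | mk I => ?_
      have h1 : (1 : K) ∈ I.1 / I₀.1 * (I₀.1 / I.1) := hEw.eqvGen_iff.1 (Quot.eqvGen_exact hq)
      obtain ⟨hML, hLinv, hLI⟩ := div_invertible_and_div_mul_eq_of_one_mem (hid I₀) (hne I₀) I.2.1 I₀.2.1 (hmr I I₀) h1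
      have hL0 : I.1 / I₀.1 ≠ 0 := fun h => I.2.1 (by rw [← hLI, h, zero_mul])
      obtain ⟨hLL, hLPic⟩ := mul_div_self_div_eq_div_self_of_mul_eq (hid I₀) (hne I₀) hML hLinv
      refine ⟨Quot.mk _ ⟨I.1 / I₀.1, ⟨hL0, by rw [hLL]; exact I₀.2.2⟩, hLPic⟩, Subtype.ext (Quot.sound ⟨1, one_ne_zero, ?_⟩)⟩
      simp only
      rw [spanSingleton_one, one_mul, hLI]
  -- count fibrewise
  rw [Nat.card_congr (Equiv.sigmaFiberEquiv π).symm, Nat.card_sigma, Finset.sum_congr rfl fun q₀ _ => hfib q₀,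
    Finset.sum_const, Finset.card_univ, ← Nat.card_eq_fintype_card, smul_eq_mul]

/-- **`#ICM(𝔯) = Σ_S #W̄k(S) · #Pic(S)`** over the over-orders `S` of `𝔯` (THEOREM 4.6 summed over the strata of
`CMOrderIdealClassMonoidOverorderCount.natCard_quot_fractionalIdeal_eq_sum_natCard_quot_stratum`) — «we can compute the
ideal class monoid of an order `R` if we know all its over-orders, their Picard groups and the weak equivalence class
monoid». [cite: Marseglia2019, §4 Thm. 4.6 and Remark 4.7 (after), p. 9] -/
theorem natCard_quot_fractionalIdeal_eq_sum_natCard_quot_weak_mul_natCard_quot_pic :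
    Nat.card (Quot fun M N : {M : FractionalIdeal (endOrder ρ)⁰ K // M ≠ 0} =>
      ∃ x : K, x ≠ 0 ∧ (M : FractionalIdeal (endOrder ρ)⁰ K) = spanSingleton (endOrder ρ)⁰ x * N) =
      ∑ S ∈ (finite_setOf_overorder (ρ := ρ) (K := K)).toFinset,
        Nat.card (Quot fun M N : {M : FractionalIdeal (endOrder ρ)⁰ K //
            M ≠ 0 ∧ ((M / M : FractionalIdeal (endOrder ρ)⁰ K) : Set K) = S} =>
          (1 : K) ∈ (M : FractionalIdeal (endOrder ρ)⁰ K) / N * (N / M)) *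
        Nat.card (Quot fun L N : {L : FractionalIdeal (endOrder ρ)⁰ K //
            (L ≠ 0 ∧ ((L / L : FractionalIdeal (endOrder ρ)⁰ K) : Set K) = S) ∧ L * (L / L / L) = L / L} =>
          ∃ x : K, x ≠ 0 ∧ (L : FractionalIdeal (endOrder ρ)⁰ K) = spanSingleton (endOrder ρ)⁰ x * N) := by
  rw [natCard_quot_fractionalIdeal_eq_sum_natCard_quot_stratum]
  exact Finset.sum_congr rfl fun S _ => natCard_quot_stratum_eq_natCard_quot_weak_mul_natCard_quot_pic S

/-- **`W̄k(S) = {[S]}` ⟹ `#ICM_S(𝔯) = #Pic(S)`**: if all ideals of the (nonempty) stratum of `S` are pairwise weakly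
equivalent (e.g. `S` Gorenstein), the stratum is ONE `Pic(S)`-torsor («`W̄k(S) = {[S]}` if and only if `S` is
Gorenstein»). [cite: Marseglia2019, §4 Thm. 4.6 with the remark after Def. 4.2, pp. 8–9] -/
theorem natCard_quot_stratum_eq_natCard_quot_pic_of_forall_one_mem (S : Subring K)
    (hne : ∃ M : FractionalIdeal (endOrder ρ)⁰ K, M ≠ 0 ∧ ((M / M : FractionalIdeal (endOrder ρ)⁰ K) : Set K) = S)
    (hwk : ∀ M N : FractionalIdeal (endOrder ρ)⁰ K, M ≠ 0 → ((M / M : FractionalIdeal (endOrder ρ)⁰ K) : Set K) = S →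
      N ≠ 0 → ((N / N : FractionalIdeal (endOrder ρ)⁰ K) : Set K) = S → (1 : K) ∈ M / N * (N / M)) :
    Nat.card (Quot fun M N : {M : FractionalIdeal (endOrder ρ)⁰ K //
        M ≠ 0 ∧ ((M / M : FractionalIdeal (endOrder ρ)⁰ K) : Set K) = S} =>
      ∃ x : K, x ≠ 0 ∧ (M : FractionalIdeal (endOrder ρ)⁰ K) = spanSingleton (endOrder ρ)⁰ x * N) =
    Nat.card (Quot fun L N : {L : FractionalIdeal (endOrder ρ)⁰ K //
        (L ≠ 0 ∧ ((L / L : FractionalIdeal (endOrder ρ)⁰ K) : Set K) = S) ∧ L * (L / L / L) = L / L} =>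
      ∃ x : K, x ≠ 0 ∧ (L : FractionalIdeal (endOrder ρ)⁰ K) = spanSingleton (endOrder ρ)⁰ x * N) := by
  rw [natCard_quot_stratum_eq_natCard_quot_weak_mul_natCard_quot_pic S]
  have h1 : Nat.card (Quot fun M N : {M : FractionalIdeal (endOrder ρ)⁰ K //
        M ≠ 0 ∧ ((M / M : FractionalIdeal (endOrder ρ)⁰ K) : Set K) = S} =>
      (1 : K) ∈ (M : FractionalIdeal (endOrder ρ)⁰ K) / N * (N / M)) = 1 := by
    obtain ⟨M, hM0, hMS⟩ := hne
    rw [Nat.card_eq_one_iff_unique]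
    refine ⟨⟨fun a b => ?_⟩, ⟨Quot.mk _ ⟨M, hM0, hMS⟩⟩⟩
    induction a using Quot.ind with | mk I => ?_
    induction b using Quot.ind with | mk J => ?_
    exact Quot.sound (hwk I.1 J.1 I.2.1 I.2.2 J.2.1 J.2.2)
  rw [h1, one_mul]

end AnyOrder

end EndOrder

end Literature.NumberTheory.ComplexMultiplication
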